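import Literature.NumberTheory.LFunctions.WeilBochnerRepresentation
import Literature.NumberTheory.LFunctions.UniformWeilPositivityRH
import Summits.RiemannHypothesis.RiemannHypothesis.Theorems.GroundBartaEvenWinsBeyondArchPositivity8046
import HarnessLib

/-!
# RiemannHypothesis — the Bochner–Kreĭn reading of the Weil-positivity ladder

Helper file (`--supports stmt-RiemannHypothesis-0098`), RH-free, standard axioms.  Seat rh-explicit
weil-3 (structure): what a proved rung `WeilPositivityOn b` MEANS.

By `Literature.NumberTheory.LFunctions.WeilBochner.weilPositivityOn_iff_exists_measure` (Kreĭn 1940 /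
Boas–Kac / Riesz–Markov, landed as `WeilBochnerRepresentation.lean`), for `b > 0`

  `WeilPositivityOn b ↔ ∃ μ ≥ 0 on ℝ, ∀ g ∈ C_c^∞[-b, b], W(g ⋆ g̃) = ∫ ‖ĝ(½+it)‖² dμ(t)`.

This file records:
* `riemannHypothesis_iff_forall_exists_measure` — **RH ⟺ for every `b > 0` the window moment problem
  is solvable**: `RH ↔ ∀ b > 0, ∃ μ_b, ∀ g ∈ C_c^∞[-b, b], Re W(g ⋆ g̃) = ∫ ‖ĝ(½+it)‖² dμ_b`
  (with `riemannHypothesis_iff_forall_weilPositivityOn`).  The ladder of rungs is a ladder of moment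
  problems on the critical line; each rung is ONE of them.
* `exists_measure_8046` — **unconditionally**, at the tree's frontier rung `b = 4023/5000`
  (`EvenWinsBeyondArch.weilPositivityOn_8046`, kernel-checked certificate): there IS a positive regular
  Borel measure `μ` on `ℝ` with `W(g ⋆ g̃) = ∫ ‖ĝ(½+it)‖² dμ(t)` and `‖ĝ(½+it)‖² ∈ L¹(μ)` for every
  smooth `g` supported in `[-0.8046, 0.8046]` — i.e. for every observable whose prime side lives in
  `[-1.6092, 1.6092]` (prime powers `2, 3, 4` visible) the zeros of `ζ` are a positive measure on the
  critical line.  `exists_measure_of_le_8046`: the same on every window `0 < b ≤ 4023/5000`.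
-/

noncomputable section

set_option linter.dupNamespace false  -- the mandated namespace repeats `RiemannHypothesis`

open Complex Set MeasureTheory
open Literature.NumberTheory.LFunctions

namespace Summit.RiemannHypothesis.RiemannHypothesis.Theorems.WeilBochnerRungs

/-- **RH ⟺ every window moment problem is solvable.**  `RiemannHypothesis ↔ ∀ b > 0, ∃ μ (measure on
ℝ), ∀ g smooth with supp g ⊆ [-b, b], Re W(g ⋆ g̃) = ∫ ‖ĝ(½+it)‖² dμ(t)`
(`riemannHypothesis_iff_forall_weilPositivityOn` + `WeilBochner.weilPositivityOn_iff_exists_measure`).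
[folklore] -/
theorem riemannHypothesis_iff_forall_exists_measure :
    _root_.RiemannHypothesis ↔ ∀ b : ℝ, 0 < b → ∃ μ : Measure ℝ, ∀ g : ℝ → ℂ, IsWeilTest g →
      tsupport g ⊆ Icc (-b) b →
        (weilQuadratic g).re = ∫ t, ‖weilMellin g (1 / 2 + t * I)‖ ^ 2 ∂μ := by
  rw [riemannHypothesis_iff_forall_weilPositivityOn]
  exact forall₂_congr fun b hb ↦ WeilBochner.weilPositivityOn_iff_exists_measure hb

/-- **The frontier rung as a measure (unconditional).**  There is a positive regular Borel measure `μ`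
on `ℝ` such that for every smooth `g` supported in `[-4023/5000, 4023/5000]` the density
`‖ĝ(½+it)‖²` is `μ`-integrable and `W(g ⋆ g̃) = ∫ ‖ĝ(½+it)‖² dμ(t)`
(`EvenWinsBeyondArch.weilPositivityOn_8046` + `WeilBochner.exists_measure_of_weilPositivityOn`).
[folklore] -/
theorem exists_measure_8046 :
    ∃ μ : Measure ℝ, μ.Regular ∧ ∀ g : ℝ → ℂ, IsWeilTest g →
      tsupport g ⊆ Icc (-(4023 / 5000 : ℝ)) (4023 / 5000) →
        Integrable (fun t : ℝ ↦ ‖weilMellin g (1 / 2 + t * I)‖ ^ 2) μ ∧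
          weilQuadratic g = ((∫ t, ‖weilMellin g (1 / 2 + t * I)‖ ^ 2 ∂μ : ℝ) : ℂ) :=
  WeilBochner.exists_measure_of_weilPositivityOn (by norm_num) EvenWinsBeyondArch.weilPositivityOn_8046

/-- The same on every window `0 < b ≤ 4023/5000` (`EvenWinsBeyondArch.weilPositivityOn_of_le_8046`).
[folklore] -/
theorem exists_measure_of_le_8046 {b : ℝ} (hb : 0 < b) (hb' : b ≤ 4023 / 5000) :
    ∃ μ : Measure ℝ, μ.Regular ∧ ∀ g : ℝ → ℂ, IsWeilTest g → tsupport g ⊆ Icc (-b) b →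
      Integrable (fun t : ℝ ↦ ‖weilMellin g (1 / 2 + t * I)‖ ^ 2) μ ∧
        weilQuadratic g = ((∫ t, ‖weilMellin g (1 / 2 + t * I)‖ ^ 2 ∂μ : ℝ) : ℂ) :=
  WeilBochner.exists_measure_of_weilPositivityOn hb (EvenWinsBeyondArch.weilPositivityOn_of_le_8046 hb')

end Summit.RiemannHypothesis.RiemannHypothesis.Theorems.WeilBochnerRungs

end
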